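/-
Copyright (c) 2026 the pub-hodgecm-mathlib formalisation cell (harness21).  Prover seat hodgecm-mathlib-K2E5-p17 (g9), Track B «K2-LIT»,
#184♮ = hLiu418 = `stmt-HodgeConjecture-24832`; socket #41 — THE TOP, edition 18 «(β) END INSIDE»: edition 17 with the KIND-0 big-cell faces block (★ p862134's 15 letters
`P₈ hPS {ι₈ ι₈'} I₈ TF q hq A₈ hA₈ c₈ hc₈ N₈ hN₈ hB`) REPLACED by the two visible letters of ★ (β) END `K2LiuBigCellContinuation.exists_bigCell_continuation_cm` (K2Liu-p13 (g4)):
`hram` (ramification exactly on `S`) and the archimedean face `hArch` ((E8) END, K2Liu-p11) (author of record by lineage).  THEOREMS ONLY; NO `Lines` import.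
-/
import Summits.HodgeConjecture.HodgeConjecture.Theorems.K2LiuSiegelEisensteinConstantTermFiniteness        -- ★ ed. 4a′ (this seat) ⊇ ed. 4a ⊇ ed. 3b
import Summits.HodgeConjecture.HodgeConjecture.Theorems.K2LiuSiegelEisensteinKindZeroBigCellLetters         -- ★ p861499 `standardFamily_growth`
import Summits.HodgeConjecture.HodgeConjecture.Theorems.K2LiuSiegelEisensteinBigCellTermPackageCM          -- ★ p861474 `exists_bigCell_termPackage_cm` (P₈ = {½}, scalar b^S∕a^S)
import Summits.HodgeConjecture.HodgeConjecture.Theorems.K2LiuKindOneLettersOfRecord                        -- ★ p862409 `exists_kindOne_sixLetters_of_record` (KIND 1 at the letters of record, F0P2-p11)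
import Summits.HodgeConjecture.HodgeConjecture.Theorems.K2LiuKindOneWeightsOfDecay                         -- ★ p862451 `kindOne_weight_of_decay` (KIND-1 weights from (L-dec) + (L-supp), F0P2-p11 over ★ p862095)
import Summits.HodgeConjecture.HodgeConjecture.Theorems.K2LiuFourierCoeffDeltaContinuous                 -- ★ p861715 `continuous_fourierCoeffDelta_eisenstein{Series,Family}Delta` (`hRKc` paid)
import Summits.HodgeConjecture.HodgeConjecture.Theorems.K2LiuSiegelEisensteinCoeffNondegenerateCurve      -- ★ Φ2 `fourierCoeffDelta_eisensteinFamilyDelta_eq_curve` (`E_S = (∫β)⁻¹·W_S`, `det S ≠ 0`)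
import Summits.HodgeConjecture.HodgeConjecture.Theorems.K2LiuSiegelEisensteinMiddleTermOfStandardLevel     -- ★ p862751 `exists_middleTerm_package_of_standard_level` (I4 ED. 5 «PREIMAGE LEVEL», K2E4-p11 ⊇ ★ I3 ED. 2 p862687, ★ ED. 2–4)
import Summits.HodgeConjecture.HodgeConjecture.Theorems.K2LiuSiegelMiddleTermCharacterNormTrivial          -- ★ `toHeckeCharacter_inv_conj_mul_self_eq_one` (`hχc` of I4 at `χ = toHeckeCharacter L lam⁻¹`)
import Summits.HodgeConjecture.HodgeConjecture.Theorems.K2LiuSiegelEisensteinWhittakerFactorLetters        -- ★ p862137 `exists_whittaker_factorLetters_of_weightLetters` (KIND W ED. 2, F0P2-p08 ∘ K2E4-p10 ★ p862095)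
import Summits.HodgeConjecture.HodgeConjecture.Theorems.K2LiuBigCellContinuation                            -- ★ (β) END `exists_bigCell_continuation_cm` (K2Liu-p13 (g4); ⊇ ★ p862134, (E10), (E10a), (F-GK-4) ED. 3, p862168, p862179)
import Summits.HodgeConjecture.HodgeConjecture.Theorems.K2LiuSiegelEisensteinWhittakerTermPackageFixedCarrier  -- ★ p861446 `exists_whittaker_packages_fourierCoeff_fixedCarrier`
import Summits.HodgeConjecture.HodgeConjecture.Theorems.K2LiuSiegelEisensteinWhittakerMajorant              -- ★ p861512 `whittaker_majorant∕summedGrowth_of_weightedGrowth`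
import HarnessLib

/-!
# Crux `HLiu418`, socket #41 — THE TOP, edition 18 «(β) END INSIDE»: edition 17 with the KIND-0 big-cell SUMMED-FACES block (★ p862134's 15 letters) REPLACED by the two visible
# letters `hram`, `hArch` of ★ (β) END `K2LiuBigCellContinuation.exists_bigCell_continuation_cm` (K2Liu-p13 (g4))

Cell `hodgecm-mathlib`, crux item hLiu418 = `stmt-HodgeConjecture-24832` (helper lane until the typist's tie; count-neutral).

THE (β) BIG-CELL CONTINUATION (★ `K2LiuBigCellContinuation.exists_bigCell_continuation_cm`, K2Liu-p13 (g4), over ★ (E10a) `exists_isStd_adaptedEverywhere`, ★ p861688 reduction, ★ E3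
`exists_eulerHead_intertwiningDelta`, ★ (F-GK-4) ED. 3 p862469, ★ p862179 tail scalar, ★ (E6′) p862350, ★ (E10) p862644 local faces, ★ (E9) p862520, ★ p862168 `eulerFace_of_letters'`,
★ p862134 point continuation): for `n = 2`, a standard datum, `χ = toHeckeCharacter L lam⁻¹` with `lam` conjugate-symplectic, a standard continuous family `f`, and `S` finite with
`ε_{L∕L⁺}` unramified EXACTLY off `S`, MODULO THE ARCHIMEDEAN FACE `hArch` (for every standard datum `𝒦′`, every (E6′) arch datum `(s₀, A)`, every `κ ∈ 𝒦′.K` and every σ-finite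
Haar `ν_∞` on `N_Δ(L⁺ ⊗ ℝ)`: the arch block `p ↦ H_∞(w_Δ p κ_∞)^{2(s−s₀)} A(w_Δ p κ_∞)` is integrable for `1 < re s` with a holomorphic integral on `{0 < re}`): `∃ E` holomorphic with
`E s x = (L^S(2s+1)L^S(2s+2,ε))∕(L^S(2s)L^S(2s−1,ε)) · M(s)f_s(x)` on `{n∕2 < re s}` — EXACTLY the triple `(E, hEd, hEeq)` ★ p861474 `exists_bigCell_termPackage_cm` consumes.
THIS EDITION: the K0-β block becomes `(hram) (hArch)` (the K0-a letters `{S} hS hur` stay; the tie now pays `S := {v | ¬ ε.IsUnramifiedAt v}`, `hur`∕`hram` by `not_not`∕`id`);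
inside `obtain ⟨E, hEd, hEeq⟩ := exists_bigCell_continuation_cm … hS hur hram hArch` replaces ★ p862134's call; everything else as edition 17 (K0-mid = ★ p862751 I4 ED. 5's visible
letters at generic `n`; KIND 1 at the letters of record ★ p862409 ∕ ★ p862451; KIND W ★ p862137; identity cell ★ p861499; O41.4 ★ ed. 4a′; KIND-0 assembly ★ ed. 4a) into ★ ed. 3b at `P := {½}`.
WHAT REMAINS BY VALUE (K2E3-typ2's block names): C carrier (tie-paid), K0-a `(wq hwq) {S} hS hur` (tie-paid), **K0-β `hram hArch`** (`hram` tie-paid; `hArch` = (E8) END K2Liu-p11),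
K0-mid `{g₀} χ₀ hχ₀ hg₀ Λ hΛ hΛc KG hKGo hKGfi hΛK Γ₀ hΓ₀ {β₁} hβ₁ F hF hint hFhol`, K1-b♮, K1-a♮, KW.
HEAD **`siegelEisensteinContinuation_eighteen`** ⇒ socket #41's body BYTES VERBATIM.
Sources: [Tan1999, §1 Main Theorem; §3; §4 Props. 4.1, 4.4, 4.8]; [MoeglinWaldspurger1995, I.2.6, II.1.7, IV.1.8–IV.1.11]; [KudlaRallis1994, §1–§2, (2.10)–(2.12)]; [KudlaSweet1997, §1];
[HarrisKudlaSweet1996, §6 (6.14)–(6.16)]; [BorelJacquet1979, §1.1, §4.1]; [Shimura1997, §18.4, Prop. 18.14]; [Liu2021, Lem. B.10 (2), B.12].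
HONEST LABEL.  Count-neutral helper until tied; `HC_CM` is proved only modulo the 7 printed citations (2 remaining named inputs: hLiu418 = `stmt-HodgeConjecture-24832`,
h413 = `stmt-HodgeConjecture-24833`) until rung 0 closes.
-/

set_option autoImplicit false
set_option linter.dupNamespace false -- the mandated namespace repeats `HodgeConjecture.HodgeConjecture`

noncomputable section

open scoped Matrix Topology ENNReal NNReal BigOperators ComplexConjugate
open NumberField IsDedekindDomain MeasureTheory Filter
open Literature.NumberTheory.Automorphic Literature.NumberTheory.GaloisRepresentations
open Literature.NumberTheory.GelbartRogawski1991 Literature.NumberTheory.GelbartRogawski1991.GRConstruction Literature.NumberTheory.GelbartRogawski1991.AdaptedBlocks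
open Literature.NumberTheory.K2Lit.SiegelDoubled Literature.MeasureTheory.Group
open Literature.NumberTheory.Automorphic.IdeleClassGroup

namespace Summit.HodgeConjecture.HodgeConjecture.Cruxes.HLiu418.K2LiuSiegelEisensteinContinuationTopEighteen

open K2LiuSiegelUnipotentFourierDefs K2LiuSiegelUnipotentLocalDefs K2LiuSiegelEisensteinContinuationTopKinds K2LiuSiegelEisensteinConstantTermPackage K2LiuSiegelEisensteinConstantTermFiniteness
open K2LiuSiegelEisensteinKindZeroBigCellLetters (standardFamily_growth)
open K2LiuSiegelEisensteinBigCellTermPackageCM (exists_bigCell_termPackage_cm)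
open K2LiuKindOneLettersOfRecord (exists_kindOne_sixLetters_of_record)
open K2LiuKindOneWeightsOfDecay (kindOne_weight_of_decay)
open K2LiuFourierCoeffDeltaContinuous (continuous_fourierCoeffDelta_eisensteinSeriesDelta)
open K2LiuSiegelEisensteinCoeffNondegenerateCurve (fourierCoeffDelta_eisensteinFamilyDelta_eq_curve)
open K2LiuSiegelEisensteinMiddleTermOfStandardLevel (exists_middleTerm_package_of_standard_level)
open K2LiuSiegelMiddleTermCharacterNormTrivial (toHeckeCharacter_inv_conj_mul_self_eq_one)
open K2LiuSiegelEisensteinWhittakerFactorLetters (exists_whittaker_factorLetters_of_weightLetters)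
open K2LiuBigCellContinuation (exists_bigCell_continuation_cm)
open K2LiuSiegelEisensteinWhittakerTermPackageFixedCarrier (exists_whittaker_packages_fourierCoeff_fixedCarrier)
open K2LiuSiegelEisensteinWhittakerMajorant (whittaker_majorant_of_weightedGrowth whittaker_summedGrowth_of_weightedGrowth)

open Classical in
/-- **SOCKET #41, (β) END INSIDE (edition 18).**  Edition 17 with the KIND-0 big-cell faces block replaced by the two visible letters of ★ (β) END
`K2LiuBigCellContinuation.exists_bigCell_continuation_cm` (K2Liu-p13): `hram` (the quadratic character is ramified exactly on `S`) and the archimedean face `hArch` ((E8) END, K2Liu-p11);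
inside the (β) head gives `(E, hEd, hEeq)` for ★ p861474.  Everything else as edition 17 (K0-mid ★ p862751's visible letters, KIND 1 ★ p862409 ∕ ★ p862451, KIND W ★ p862137, `P = {½}`)
into ★ ed. 3b.  THEN socket #41's `∃ P Es, …`.
[cite: Tan1999, §1 Main Theorem; §3; §4 Props. 4.1, 4.4, 4.8] [cite: MoeglinWaldspurger1995, I.2.6, II.1.7, IV.1.8–IV.1.11] [cite: KudlaRallis1994, §1–§2, (2.10)–(2.12)]
[cite: HarrisKudlaSweet1996, §6 (6.14)–(6.16)] [cite: BorelJacquet1979, §1.1, §4.1] [cite: Shimura1997, §18.4, Prop. 18.14] [cite: Liu2021, Lem. B.10 (2), B.12] -/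
theorem siegelEisensteinContinuation_eighteen
    (L : Type) [Field L] [NumberField L] [IsCMField L] {n : ℕ} (e : Fin 2 × Fin 1 ≃ Fin n)
    (dV : Fin 2 → L) (hdV : ∀ i, IsCMField.complexConj L (dV i) = dV i) (hdV0 : ∀ i, dV i ≠ 0)
    (dW : Fin 1 → L) (hdW : ∀ i, IsCMField.complexConj L (dW i) = dW i) (hdW0 : ∀ i, dW i ≠ 0)
    (lam : IdeleClassGroup L →ₜ* Circle) (hlam : IsConjugateSymplectic L lam) (hw : HasWeight L lam 1)
    (𝒦 : IwasawaDatum L e dV hdV dW hdW) (h𝒦 : 𝒦.IsStd) (f : ℂ → HA L e dV hdV dW hdW → ℂ)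
    (hstd : IsStandardSectionFamily 𝒦 (toHeckeCharacter L lam⁻¹) f) (hcont : ∀ s, Continuous (f s))
    -- the carrier (built by the tie as in ★ edition 2: Haar + ★ (C0) + ★ covering weight)
    [MeasurableSpace (unipDelta L e dV hdV dW hdW)] [BorelSpace (unipDelta L e dV hdV dW hdW)]
    (νN : Measure (unipDelta L e dV hdV dW hdW)) [νN.IsHaarMeasure]
    (β : unipDelta L e dV hdV dW hdW → ℝ≥0∞) (hβ : IsCoveringWeight (unipDeltaRat L e dV hdV dW hdW) β)
    (hβ0 : ∫⁻ u, β u ∂νN ≠ 0) (hβtop : ∫⁻ u, β u ∂νN ≠ ∞)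
    {K : Set (unipDelta L e dV hdV dW hdW)} (hK : IsCompact K) (hβK : ∀ u, β u ≤ K.indicator 1 u)
    -- KIND 0: rational Weyl presentation; big cell = ★ p861474's continuation letters `(S, hS, hur, E, hEd, hEeq)`; middle package
    (wq : unipDeltaRat L e dV hdV dW hdW → ratH L e dV hdV dW hdW)
    (hwq : ∀ ν, ((wq ν : ratH L e dV hdV dW hdW) : HA L e dV hdV dW hdW) = weylDelta L e dV hdV dW hdW * ((ν : unipDelta L e dV hdV dW hdW) : HA L e dV hdV dW hdW))
    {S : Set (HeightOneSpectrum (𝓞 ↥(maximalRealSubfield L)))} (hS : S.Finite) (hur : ∀ v ∉ S, (quadraticHeckeCharCM L).IsUnramifiedAt v)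
    -- KIND 0 big cell: ★ (β) END `K2LiuBigCellContinuation.exists_bigCell_continuation_cm` (K2Liu-p13) — ramification EXACTLY on `S` (`hram`) and THE ARCHIMEDEAN FACE BY VALUE ((E8) END, K2Liu-p11):
    -- for every standard datum, every (E6′) arch datum `(s₀, A)` and every `κ`, the arch block of the big cell is integrable on `1 < re s` with a holomorphic integral on `{0 < re}`
    (hram : ∀ v ∈ S, ¬ (quadraticHeckeCharCM L).IsUnramifiedAt v)
    (hArch : ∀ (𝒦' : IwasawaDatum L e dV hdV dW hdW), 𝒦'.IsStd →
      ∀ (s₀ : ℂ) (A : UnitaryGroup.arch (Fp L) L (IsCMField.complexConj L) (n + n) (hermD L e dV hdV dW hdW) → ℂ),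
        (∀ p : HA L e dV hdV dW hdW, IsSiegelDelta L e dV hdV dW hdW p → UnitaryGroup.finPart (Fp L) L (IsCMField.complexConj L) (n + n) (hermD L e dV hdV dW hdW) p = 1 →
          ∀ x : UnitaryGroup.arch (Fp L) L (IsCMField.complexConj L) (n + n) (hermD L e dV hdV dW hdW),
            A (UnitaryGroup.archPart (Fp L) L (IsCMField.complexConj L) (n + n) (hermD L e dV hdV dW hdW) p * x) = siegelDeltaCharacter L e dV hdV dW hdW (toHeckeCharacter L lam⁻¹) s₀ p * A x) →
        (∃ V : Submodule ℂ (UnitaryGroup.arch (Fp L) L (IsCMField.complexConj L) (n + n) (hermD L e dV hdV dW hdW) → ℂ), FiniteDimensional ℂ V ∧ A ∈ V ∧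
          ∀ a₀ : UnitaryGroup.arch (Fp L) L (IsCMField.complexConj L) (n + n) (hermD L e dV hdV dW hdW),
            (UnitaryGroup.archToAdelic (Fp L) L (IsCMField.complexConj L) (n + n) (hermD L e dV hdV dW hdW) a₀ : HA L e dV hdV dW hdW) ∈ 𝒦'.K → ∀ G ∈ V, (fun x => G (x * a₀)) ∈ V) →
        Continuous A →
        ∀ κ : HA L e dV hdV dW hdW, κ ∈ 𝒦'.K →
          ∀ {_ : MeasurableSpace ↥(unipDeltaArch L e dV hdV dW hdW)} [BorelSpace ↥(unipDeltaArch L e dV hdV dW hdW)]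
            (νinf : Measure ↥(unipDeltaArch L e dV hdV dW hdW)) [νinf.IsHaarMeasure] [SigmaFinite νinf],
            (∀ s : ℂ, 1 < s.re → Integrable (fun p : ↥(unipDeltaArch L e dV hdV dW hdW) =>
              ((modDelta L e dV hdV dW hdW (𝒦'.pPart (UnitaryGroup.archToAdelic (Fp L) L (IsCMField.complexConj L) (n + n) (hermD L e dV hdV dW hdW)
                  (UnitaryGroup.archPart (Fp L) L (IsCMField.complexConj L) (n + n) (hermD L e dV hdV dW hdW) (weylDelta L e dV hdV dW hdW) *
                    (p : UnitaryGroup.arch (Fp L) L (IsCMField.complexConj L) (n + n) (hermD L e dV hdV dW hdW)) *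
                    UnitaryGroup.archPart (Fp L) L (IsCMField.complexConj L) (n + n) (hermD L e dV hdV dW hdW) κ))) : ℝ) : ℂ) ^ (2 * (s - s₀)) *
                A (UnitaryGroup.archPart (Fp L) L (IsCMField.complexConj L) (n + n) (hermD L e dV hdV dW hdW) (weylDelta L e dV hdV dW hdW) *
                    (p : UnitaryGroup.arch (Fp L) L (IsCMField.complexConj L) (n + n) (hermD L e dV hdV dW hdW)) *
                    UnitaryGroup.archPart (Fp L) L (IsCMField.complexConj L) (n + n) (hermD L e dV hdV dW hdW) κ)) νinf) ∧
            ∃ Ea : ℂ → ℂ, DifferentiableOn ℂ Ea {s : ℂ | 0 < s.re} ∧ ∀ s : ℂ, 1 < s.re →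
              ∫ p : ↥(unipDeltaArch L e dV hdV dW hdW),
                ((modDelta L e dV hdV dW hdW (𝒦'.pPart (UnitaryGroup.archToAdelic (Fp L) L (IsCMField.complexConj L) (n + n) (hermD L e dV hdV dW hdW)
                  (UnitaryGroup.archPart (Fp L) L (IsCMField.complexConj L) (n + n) (hermD L e dV hdV dW hdW) (weylDelta L e dV hdV dW hdW) *
                    (p : UnitaryGroup.arch (Fp L) L (IsCMField.complexConj L) (n + n) (hermD L e dV hdV dW hdW)) *
                    UnitaryGroup.archPart (Fp L) L (IsCMField.complexConj L) (n + n) (hermD L e dV hdV dW hdW) κ))) : ℝ) : ℂ) ^ (2 * (s - s₀)) *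
                A (UnitaryGroup.archPart (Fp L) L (IsCMField.complexConj L) (n + n) (hermD L e dV hdV dW hdW) (weylDelta L e dV hdV dW hdW) *
                    (p : UnitaryGroup.arch (Fp L) L (IsCMField.complexConj L) (n + n) (hermD L e dV hdV dW hdW)) *
                    UnitaryGroup.archPart (Fp L) L (IsCMField.complexConj L) (n + n) (hermD L e dV hdV dW hdW) κ) ∂νinf = Ea s)
    -- KIND 0 middle term: ★ p862751 (K2E4-p11) I4 ED. 5 «PREIMAGE LEVEL» letters BY VALUE, stated at the socket's generic `n` (`= 2`): the datum of ★ α3-2 — the middle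
    -- reflection `g₀` (0∕1 pattern `χ₀` at index `1`), the Levi chart `Λ` with its block form and continuity —, the PREIMAGE-LEVEL block (`KG ≤ K_{GL_n}` open of finite index with
    -- `Λ(KG) ⊆ 𝒦.K`; RULING M-158j), the stabiliser lattice `Γ₀` with a `Γ₀`-covering weight `β₁`, the inner section `F` of the middle cell with its two analytic letters on `H(𝔸)`
    {g₀ : UnitaryGroup.rationalPair (Fp L) L (IsCMField.complexConj L) 2 1 (Matrix.diagonal dV) (Matrix.diagonal dW)}
    (χ₀ : Fin n → L) (hχ₀ : ∀ j : Fin n, χ₀ j = if (j : ℕ) = 1 then 1 else 0)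
    (hg₀ : ((g₀ : GL (Fin 2 × Fin 1) L) : Matrix (Fin 2 × Fin 1) (Fin 2 × Fin 1) L) = Matrix.diagonal (fun k => 1 - 2 * χ₀ (e k)))
    (Λ : GL (Fin n) (AdeleRing (𝓞 L) L) →* HA L e dV hdV dW hdW)
    (hΛ : ∀ g : GL (Fin n) (AdeleRing (𝓞 L) L), blk L e dV hdV dW hdW (Λ g) =
      cayR (AdeleRing (𝓞 L) L) (Fin n) * Matrix.fromBlocks (g : Matrix (Fin n) (Fin n) (AdeleRing (𝓞 L) L)) 0 0
        (((gramR L e dV hdV dW hdW).map ((algebraMap L (AdeleRing (𝓞 L) L)).comp (algebraMap (Fp L) L)))⁻¹ *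
          (((g⁻¹ : GL (Fin n) (AdeleRing (𝓞 L) L)) : Matrix (Fin n) (Fin n) (AdeleRing (𝓞 L) L)).map
            (UnitaryGroup.conjAdele (Fp L) L (IsCMField.complexConj L)))ᵀ *
          (gramR L e dV hdV dW hdW).map ((algebraMap L (AdeleRing (𝓞 L) L)).comp (algebraMap (Fp L) L))) *
        cayRinv (AdeleRing (𝓞 L) L) (Fin n))
    (hΛc : Continuous Λ)
    (KG : Subgroup (GL (Fin n) (AdeleRing (𝓞 L) L)))
    (hKGo : IsOpen ((KG.subgroupOf (standardMaximalCompactGL n L) : Subgroup ↥(standardMaximalCompactGL n L)) : Set ↥(standardMaximalCompactGL n L)))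
    (hKGfi : (KG.subgroupOf (standardMaximalCompactGL n L)).FiniteIndex)
    (hΛK : ∀ k ∈ KG, Λ k ∈ 𝒦.K)
    (Γ₀ : Subgroup (unipDelta L e dV hdV dW hdW))
    (hΓ₀ : ∀ u : unipDelta L e dV hdV dW hdW, u ∈ Γ₀ ↔ (u : HA L e dV hdV dW hdW) ∈ ratH L e dV hdV dW hdW ∧
      IsSiegelDelta L e dV hdV dW hdW (iotaGG L e dV hdV dW hdW (1, UnitaryGroup.rationalPairToAdelic (Fp L) L (IsCMField.complexConj L) 2 1 (Matrix.diagonal dV) (Matrix.diagonal dW) g₀) * (u : HA L e dV hdV dW hdW) * (iotaGG L e dV hdV dW hdW (1, UnitaryGroup.rationalPairToAdelic (Fp L) L (IsCMField.complexConj L) 2 1 (Matrix.diagonal dV) (Matrix.diagonal dW) g₀))⁻¹))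
    {β₁ : unipDelta L e dV hdV dW hdW → ℝ≥0∞} (hβ₁ : IsCoveringWeight Γ₀ β₁)
    (F : ℂ → HA L e dV hdV dW hdW → ℂ)
    (hF : ∀ (s : ℂ) (x : HA L e dV hdV dW hdW), F s x = ∫ u, (β₁ u).toReal • f s (iotaGG L e dV hdV dW hdW (1, UnitaryGroup.rationalPairToAdelic (Fp L) L (IsCMField.complexConj L) 2 1 (Matrix.diagonal dV) (Matrix.diagonal dW) g₀) * ((u : HA L e dV hdV dW hdW) * x)) ∂νN)
    (hint : ∀ s : ℂ, 0 < s.re → ∀ y : HA L e dV hdV dW hdW,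
      Integrable (fun u : unipDelta L e dV hdV dW hdW => (β₁ u).toReal • f s (iotaGG L e dV hdV dW hdW (1, UnitaryGroup.rationalPairToAdelic (Fp L) L (IsCMField.complexConj L) 2 1 (Matrix.diagonal dV) (Matrix.diagonal dW) g₀) * ((u : HA L e dV hdV dW hdW) * y))) νN)
    (hFhol : ∀ y : HA L e dV hdV dW hdW, DifferentiableOn ℂ (fun s => F s y) {s : ℂ | 0 < s.re})
    -- KIND 1: THE LETTERS OF RECORD (★ p862409: `ι := Unit`, `a := 1`, `ρb := 1`, `ρa S s := (s − ½)⁻¹`, `G := 1`) — two ONE-FUNCTION packages, each: the function, its holomorphy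
    -- on `{0 < re}`, its PIN at THIS carrier `(νN, β)` on `{n∕2 < re s}` for rank-one `S`, (L-dec) height-form Gaussian decay in its own size `τ ≥ ‖S‖_∞`, (L-supp) support
    -- K1-b♮: the continued NORMALISED MIDDLE-CELL (line) term `Ebc` (`MID_S` with O41.4's rational Weyl presentation `wq`)
    (Ebc : skewMatrices ((IsCMField.complexConj L : L ≃ₐ[Fp L] L) : L →+* L) ((gramR L e dV hdV dW hdW).map (algebraMap (Fp L) L)) → ℂ → HA L e dV hdV dW hdW → ℂ)
    (hEbd : ∀ S x, DifferentiableOn ℂ (fun s => Ebc S s x) {s : ℂ | 0 < s.re})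
    (hEbc : ∀ S : skewMatrices ((IsCMField.complexConj L : L ≃ₐ[Fp L] L) : L →+* L) ((gramR L e dV hdV dW hdW).map (algebraMap (Fp L) L)),
      (S : Matrix (Fin n) (Fin n) L) ≠ 0 → (S : Matrix (Fin n) (Fin n) L).det = 0 → ∀ (s : ℂ) (h : HA L e dV hdV dW hdW), (n : ℝ) / 2 < s.re →
        ((∫⁻ u, β u ∂νN).toReal⁻¹ : ℝ) •
          (∫ u, (β u).toReal • (conj (unipDeltaChar L e dV hdV dW hdW (S : Matrix (Fin n) (Fin n) L) (u : HA L e dV hdV dW hdW) : ℂ) *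
            (∑' q : ↥(({Quotient.mk (MulAction.orbitRel (siegelDeltaRat L e dV hdV dW hdW) (ratH L e dV hdV dW hdW)) 1} ∪
              Set.range (fun ν : unipDeltaRat L e dV hdV dW hdW =>
                (Quotient.mk (MulAction.orbitRel (siegelDeltaRat L e dV hdV dW hdW) (ratH L e dV hdV dW hdW)) (wq ν) :
                  SiegelDeltaQuot L e dV hdV dW hdW)))ᶜ : Set (SiegelDeltaQuot L e dV hdV dW hdW)),
              f s ((((Quotient.out (q : SiegelDeltaQuot L e dV hdV dW hdW) : ratH L e dV hdV dW hdW) : HA L e dV hdV dW hdW)) *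
                ((u : HA L e dV hdV dW hdW) * h)))) ∂νN) = Ebc S s h)
    (τb : skewMatrices ((IsCMField.complexConj L : L ≃ₐ[Fp L] L) : L →+* L) ((gramR L e dV hdV dW hdW).map (algebraMap (Fp L) L)) → ℝ)
    (hτb : ∀ S : skewMatrices ((IsCMField.complexConj L : L ≃ₐ[Fp L] L) : L →+* L) ((gramR L e dV hdV dW hdW).map (algebraMap (Fp L) L)),
      ‖(fun i j => NumberField.mixedEmbedding L ((S : Matrix (Fin n) (Fin n) L) i j))‖ ≤ τb S) (Nb : ℕ)
    (hdecb : ∀ z : ℂ, 0 < z.re → ∃ C a c a' r : ℝ, 0 ≤ C ∧ 0 ≤ a ∧ 0 < c ∧ 0 ≤ a' ∧ 0 < r ∧ ∀ S (s : ℂ), dist s z < r → ∀ h : HA L e dV hdV dW hdW,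
      ‖Ebc S s h‖ ≤ C * adelicHeightGL (n + n) L (h : GL (Fin (n + n)) (AdeleRing (𝓞 L) L)) ^ a *
        (Real.exp (-(c * adelicHeightGL (n + n) L (h : GL (Fin (n + n)) (AdeleRing (𝓞 L) L)) ^ (-a') * τb S)) * (1 + τb S) ^ Nb))
    {Cb κb : ℝ} (hCb : 0 < Cb) (hκb : 0 ≤ κb)
    (hsuppb : ∀ S (s : ℂ) (h : HA L e dV hdV dW hdW), 0 < s.re → Ebc S s h ≠ 0 →
      ∃ D : ℕ, 1 ≤ D ∧ (D : ℝ) ≤ Cb * adelicHeightGL (n + n) L (h : GL (Fin (n + n)) (AdeleRing (𝓞 L) L)) ^ κb ∧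
        ∀ i j, IsIntegral ℤ ((D : L) * (S : Matrix (Fin n) (Fin n) L) i j))
    -- K1-a♮: the continued `(s − ½)·`NORMALISED WHITTAKER (singular) term `Eac`
    (Eac : skewMatrices ((IsCMField.complexConj L : L ≃ₐ[Fp L] L) : L →+* L) ((gramR L e dV hdV dW hdW).map (algebraMap (Fp L) L)) → ℂ → HA L e dV hdV dW hdW → ℂ)
    (hEad : ∀ S x, DifferentiableOn ℂ (fun s => Eac S s x) {s : ℂ | 0 < s.re})
    (hEac : ∀ S : skewMatrices ((IsCMField.complexConj L : L ≃ₐ[Fp L] L) : L →+* L) ((gramR L e dV hdV dW hdW).map (algebraMap (Fp L) L)),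
      (S : Matrix (Fin n) (Fin n) L) ≠ 0 → (S : Matrix (Fin n) (Fin n) L).det = 0 → ∀ (s : ℂ) (h : HA L e dV hdV dW hdW), (n : ℝ) / 2 < s.re →
        (s - 1 / 2) * (((∫⁻ u, β u ∂νN).toReal⁻¹ : ℝ) • whittakerDelta L e dV hdV dW hdW νN (S : Matrix (Fin n) (Fin n) L) (f s) h) = Eac S s h)
    (τa : skewMatrices ((IsCMField.complexConj L : L ≃ₐ[Fp L] L) : L →+* L) ((gramR L e dV hdV dW hdW).map (algebraMap (Fp L) L)) → ℝ)
    (hτa : ∀ S : skewMatrices ((IsCMField.complexConj L : L ≃ₐ[Fp L] L) : L →+* L) ((gramR L e dV hdV dW hdW).map (algebraMap (Fp L) L)),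
      ‖(fun i j => NumberField.mixedEmbedding L ((S : Matrix (Fin n) (Fin n) L) i j))‖ ≤ τa S) (Na : ℕ)
    (hdeca : ∀ z : ℂ, 0 < z.re → ∃ C a c a' r : ℝ, 0 ≤ C ∧ 0 ≤ a ∧ 0 < c ∧ 0 ≤ a' ∧ 0 < r ∧ ∀ S (s : ℂ), dist s z < r → ∀ h : HA L e dV hdV dW hdW,
      ‖Eac S s h‖ ≤ C * adelicHeightGL (n + n) L (h : GL (Fin (n + n)) (AdeleRing (𝓞 L) L)) ^ a *
        (Real.exp (-(c * adelicHeightGL (n + n) L (h : GL (Fin (n + n)) (AdeleRing (𝓞 L) L)) ^ (-a') * τa S)) * (1 + τa S) ^ Na))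
    {Ca κa : ℝ} (hCa : 0 < Ca) (hκa : 0 ≤ κa)
    (hsuppa : ∀ S (s : ℂ) (h : HA L e dV hdV dW hdW), 0 < s.re → Eac S s h ≠ 0 →
      ∃ D : ℕ, 1 ≤ D ∧ (D : ℝ) ≤ Ca * adelicHeightGL (n + n) L (h : GL (Fin (n + n)) (AdeleRing (𝓞 L) L)) ^ κa ∧
        ∀ i j, IsIntegral ℤ ((D : L) * (S : Matrix (Fin n) (Fin n) L) i j))
    -- KIND W: ★ p862137 (F0P2-p08 ∘ K2E4-p10) letters BY VALUE — Euler data `(A, U, hEuler)` at the Whittaker level, holomorphy `hAd`, and the three (W3) letters on `A`: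
    -- archimedean size `τ` with `hτ`, height-form Gaussian decay `hdec`, bounded-denominator support `hsupp`
    -- (W1) the EULER DATA by value: `T`-part `A` and exceptional place set `U(S,h) = D(S) ∪ T(S,h)`, with the Euler identity on `{n∕2 < re s}`
    (A : skewMatrices ((IsCMField.complexConj L : L ≃ₐ[Fp L] L) : L →+* L) ((gramR L e dV hdV dW hdW).map (algebraMap (Fp L) L)) → ℂ → HA L e dV hdV dW hdW → ℂ)
    (U : skewMatrices ((IsCMField.complexConj L : L ≃ₐ[Fp L] L) : L →+* L) ((gramR L e dV hdV dW hdW).map (algebraMap (Fp L) L)) → HA L e dV hdV dW hdW →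
      Set (HeightOneSpectrum (𝓞 ↥(maximalRealSubfield L))))
    (hEuler : ∀ S : skewMatrices ((IsCMField.complexConj L : L ≃ₐ[Fp L] L) : L →+* L) ((gramR L e dV hdV dW hdW).map (algebraMap (Fp L) L)),
      (S : Matrix (Fin n) (Fin n) L).det ≠ 0 → ∀ (s : ℂ) (h : HA L e dV hdV dW hdW), (n : ℝ) / 2 < s.re →
        whittakerDelta L e dV hdV dW hdW νN (S : Matrix (Fin n) (Fin n) L) (f s) h =
          A S s h * (partialStandardL (U S h) (fun _ => {1}) (2 * s + 1) *
            partialStandardL (U S h) (fun v => {(quadraticHeckeCharCM L).valueAtUniformizer v}) (2 * s + 2))⁻¹)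
    -- (W2) holomorphy of the `T`-part
    (hAd : ∀ S (h : HA L e dV hdV dW hdW), DifferentiableOn ℂ (fun s => A S s h) {s : ℂ | 0 < s.re})
    -- (W3) K2E4-p10 (g8)'s three letters on `A`
    (τ : skewMatrices ((IsCMField.complexConj L : L ≃ₐ[Fp L] L) : L →+* L) ((gramR L e dV hdV dW hdW).map (algebraMap (Fp L) L)) → ℝ)
    (hτ : ∀ S : skewMatrices ((IsCMField.complexConj L : L ≃ₐ[Fp L] L) : L →+* L) ((gramR L e dV hdV dW hdW).map (algebraMap (Fp L) L)),
      ‖(fun i j => NumberField.mixedEmbedding L ((S : Matrix (Fin n) (Fin n) L) i j))‖ ≤ τ S) (NW : ℕ)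
    (hdec : ∀ z : ℂ, 0 < z.re → ∃ C a c a' r : ℝ, 0 ≤ C ∧ 0 ≤ a ∧ 0 < c ∧ 0 ≤ a' ∧ 0 < r ∧ ∀ S (s : ℂ), dist s z < r → ∀ h : HA L e dV hdV dW hdW,
      ‖A S s h‖ ≤ C * adelicHeightGL (n + n) L (h : GL (Fin (n + n)) (AdeleRing (𝓞 L) L)) ^ a *
        (Real.exp (-(c * adelicHeightGL (n + n) L (h : GL (Fin (n + n)) (AdeleRing (𝓞 L) L)) ^ (-a') * τ S)) * (1 + τ S) ^ NW))
    {CW κ : ℝ} (hCW : 0 < CW) (hκ : 0 ≤ κ)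
    (hsupp : ∀ S (s : ℂ) (h : HA L e dV hdV dW hdW), 0 < s.re → A S s h ≠ 0 →
      ∃ D : ℕ, 1 ≤ D ∧ (D : ℝ) ≤ CW * adelicHeightGL (n + n) L (h : GL (Fin (n + n)) (AdeleRing (𝓞 L) L)) ^ κ ∧
        ∀ i j, IsIntegral ℤ ((D : L) * (S : Matrix (Fin n) (Fin n) L) i j)) :
    ∃ (P : Finset ℂ) (Es : ℂ → HA L e dV hdV dW hdW → ℂ),
      (∀ h : HA L e dV hdV dW hdW, DifferentiableOn ℂ (fun s => Es s h) {s : ℂ | 0 < s.re}) ∧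
      (∀ s : ℂ, 0 < s.re → Continuous (Es s)) ∧
      (∀ s : ℂ, 0 < s.re → ∀ (γ : ratH L e dV hdV dW hdW) (h : HA L e dV hdV dW hdW),
        Es s ((γ : HA L e dV hdV dW hdW) * h) = Es s h) ∧
      (∀ (s : ℂ) (h : HA L e dV hdV dW hdW), (n : ℝ) / 2 < s.re →
        Es s h = (∏ p ∈ P, (s - p)) * eisensteinFamilyDelta L e dV hdV dW hdW f s h) ∧
      (∀ z : ℂ, 0 < z.re → ∃ C A r : ℝ, 0 < r ∧ ∀ s : ℂ, dist s z < r → ∀ h : HA L e dV hdV dW hdW,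
        ‖Es s h‖ ≤ C * adelicHeightGL (n + n) L (h : GL (Fin (n + n)) (AdeleRing (𝓞 L) L)) ^ A) := by
  have hn : 0 < n := by
    have h2 : Fintype.card (Fin 2 × Fin 1) = Fintype.card (Fin n) := Fintype.card_congr e
    simp only [Fintype.card_prod, Fintype.card_fin] at h2
    omega
  haveI : NeZero n := ⟨hn.ne'⟩
  have hχ : (toHeckeCharacter L lam⁻¹).IsUnitary := isUnitary_toHeckeCharacter L lam⁻¹
  -- KIND W: ★ p862052 factor letters (F0P2-p08), then the Whittaker level: `E_S = (∫β)⁻¹·W_S` (★ Φ2 under ★ ed. 4a′), `WT` rescaled by `c := (∫β)⁻¹`; ★ p861446, ★ p861512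
  obtain ⟨WT, GW, w, hWTd, hGWd, hw0, hws, hg, hRKW⟩ :=
    exists_whittaker_factorLetters_of_weightLetters L hn e dV hdV dW hdW f νN A U hEuler hAd τ hτ NW hdec hCW hκ hsupp
  set c : ℝ := (∫⁻ u, β u ∂νN).toReal⁻¹ with hc
  have hWTd' : ∀ S (h : HA L e dV hdV dW hdW), DifferentiableOn ℂ (fun s => (c : ℂ) * WT S s h) {s : ℂ | 0 < s.re} :=
    fun S h => (hWTd S h).const_mul _
  have hg' : ∀ z : ℂ, 0 < z.re → ∃ C A r : ℝ, 0 ≤ C ∧ 0 ≤ A ∧ 0 < r ∧ ∀ S (s : ℂ), dist s z < r → ∀ h : HA L e dV hdV dW hdW,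
      ‖(c : ℂ) * WT S s h * GW S s h‖ ≤ C * w S * adelicHeightGL (n + n) L (h : GL (Fin (n + n)) (AdeleRing (𝓞 L) L)) ^ A := by
    intro z hz
    obtain ⟨C, A, r, hC, hA, hr, hb⟩ := hg z hz
    refine ⟨|c| * C, A, r, by positivity, hA, hr, fun S s hs h => ?_⟩
    calc ‖(c : ℂ) * WT S s h * GW S s h‖ = |c| * ‖WT S s h * GW S s h‖ := by
          rw [mul_assoc, norm_mul, Complex.norm_real, Real.norm_eq_abs]
      _ ≤ |c| * (C * w S * adelicHeightGL (n + n) L (h : GL (Fin (n + n)) (AdeleRing (𝓞 L) L)) ^ A) :=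
          mul_le_mul_of_nonneg_left (hb S s hs h) (abs_nonneg c)
      _ = |c| * C * w S * adelicHeightGL (n + n) L (h : GL (Fin (n + n)) (AdeleRing (𝓞 L) L)) ^ A := by ring
  have hRK : ∀ S : skewMatrices ((IsCMField.complexConj L : L ≃ₐ[Fp L] L) : L →+* L) ((gramR L e dV hdV dW hdW).map (algebraMap (Fp L) L)),
      (S : Matrix (Fin n) (Fin n) L).det ≠ 0 → ∀ (s : ℂ) (h : HA L e dV hdV dW hdW), (n : ℝ) / 2 < s.re →
        fourierCoeffDelta L e dV hdV dW hdW νN β (S : Matrix (Fin n) (Fin n) L) (eisensteinFamilyDelta L e dV hdV dW hdW f s) h =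
          (c : ℂ) * WT S s h * GW S s h := by
    intro S hdet s h hs
    rw [fourierCoeffDelta_eisensteinFamilyDelta_eq_curve e dV hdV hdV0 dW hdW hdW0 𝒦 hstd hcont wq hwq νN hβ s h
      (lintegral_tsum_enorm_mul_weight_ne_top L e dV hdV dW hdW hdV0 hdW0 hχ hs (hstd.1.1 s) (hcont s) νN hβtop hK hβK h) S.2 hdet,
      hRKW S hdet s h hs, Complex.real_smul, hc, mul_assoc]
  obtain ⟨EcW, hWoff, hWd, hWc, hWcoef, hWg⟩ := exists_whittaker_packages_fourierCoeff_fixedCarrier L hn e dV hdV dW hdW νN β f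
    (fun S s h => (c : ℂ) * WT S s h) GW hWTd' hGWd w hw0 hg'
    (fun S _ s hs => continuous_fourierCoeffDelta_eisensteinSeriesDelta L e dV hdV dW hdW hdV0 hdW0 νN hβ (S : Matrix (Fin n) (Fin n) L) hχ hs
      (hstd.1.1 s) (hcont s)) hRK ({(1 / 2 : ℂ)} : Finset ℂ)
  -- KIND 1 at the letters of record: the summable weights from (L-dec) + (L-supp) (★ p862451, once per term), then ★ p862409 §4 at THIS carrier (`hRK₁` at every carrier inside,
  -- `hRKc` ★ p861715 inside ★ p861869)
  obtain ⟨ub, hub, hubs, hbg⟩ := kindOne_weight_of_decay L hn e dV hdV dW hdW Ebc τb hτb Nb hdecb hCb hκb hsuppb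
  obtain ⟨uG, huG, huGs, haG⟩ := kindOne_weight_of_decay L hn e dV hdV dW hdW Eac τa hτa Na hdeca hCa hκa hsuppa
  obtain ⟨Ec₁, h1off, hd₁, hc₁, hcoef₁, hmaj₁, hgr₁⟩ := exists_kindOne_sixLetters_of_record L e dV hdV dW hdW hdV0 hdW0 hn hχ f hstd.1.1 hcont
    ({(1 / 2 : ℂ)} : Finset ℂ) (Finset.mem_singleton_self _) wq hwq νN hβ hβtop hK hβK Ebc hEbd Eac hEad ub uG hub huG hbg haG (hubs.add huGs) hEbc hEac
  -- KIND 0: big cell (★ p861499 over ★ p861423), middle (rescaled), identity (★ `standardFamily_growth`), O41.4 finiteness (★ ed. 4a′), assembly (★ ed. 4a)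
  have hn2 : n = 2 := by
    have h2 : Fintype.card (Fin 2 × Fin 1) = Fintype.card (Fin n) := Fintype.card_congr e
    simp only [Fintype.card_prod, Fintype.card_fin] at h2
    omega
  subst hn2
  -- KIND 0 middle term: ★ p862751 (I4 ED. 5 «PREIMAGE LEVEL»); the pattern `χ₀ = ![0, 1]`, `hχc` ★ `toHeckeCharacter_inv_conj_mul_self_eq_one`
  obtain rfl : χ₀ = ![0, 1] := funext fun j => by
    rw [hχ₀]
    fin_cases j <;> simp
  obtain ⟨E₇, h7d, h7c, h7eq, h7g⟩ := exists_middleTerm_package_of_standard_level L e dV hdV dW hdW hg₀ Λ hΛ Γ₀ hΓ₀ wq hwq hdV0 hdW0 νN β hβ hβtop hK hβK hχ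
    (toHeckeCharacter_inv_conj_mul_self_eq_one hlam) 𝒦 h𝒦 f hstd hcont hΛc KG hKGo hKGfi hΛK hβ₁ F hF hint hFhol
  -- KIND 0 big cell continuation: ★ (β) END `exists_bigCell_continuation_cm` (K2Liu-p13) from `hram` + the arch face `hArch`
  obtain ⟨E, hEd, hEeq⟩ := exists_bigCell_continuation_cm L e dV hdV dW hdW rfl hdV0 hdW0 𝒦 h𝒦 νN hlam hstd hcont hS hur hram hArch
  obtain ⟨Ec₈, h8d, h8c, h8eq, h8g⟩ :=
    exists_bigCell_termPackage_cm L e dV hdV dW hdW rfl hdV0 hdW0 𝒦 νN (toHeckeCharacter L lam⁻¹) hχ f hstd hcont hS hur E hEd hEeq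
  obtain ⟨h8d', h8c', h8eq', h8g'⟩ := smul_package (fun h : HA L e dV hdV dW hdW => adelicHeightGL (2 + 2) L (h : GL (Fin (2 + 2)) (AdeleRing (𝓞 L) L)))
    ((∫⁻ u, β u ∂νN).toReal⁻¹) ({(1 / 2 : ℂ)} : Finset ℂ) _ Ec₈ h8d h8c h8eq h8g
  obtain ⟨h7d', h7c', h7eq', h7g'⟩ := smul_package (fun h : HA L e dV hdV dW hdW => adelicHeightGL (2 + 2) L (h : GL (Fin (2 + 2)) (AdeleRing (𝓞 L) L)))
    ((∫⁻ u, β u ∂νN).toReal⁻¹) ({(1 / 2 : ℂ)} : Finset ℂ) _ E₇ h7d h7c h7eq h7g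
  obtain ⟨Ec₀, hd₀, hc₀, hcoef₀, hbd₀, hgr₀⟩ := exists_constantTerm_package L e dV hdV dW hdW hn νN hβ hβ0 hβtop wq hwq f hstd.1.1 hcont
    (fun h => (hstd.1.2 h).differentiableOn) (standardFamily_growth L e dV hdV dW hdW 𝒦 hχ f hstd hcont)
    (fun s h hs => lintegral_tsum_enorm_mul_weight_ne_top L e dV hdV dW hdW hdV0 hdW0 hχ hs (hstd.1.1 s) (hcont s) νN hβtop hK hβK h)
    ({(1 / 2 : ℂ)} : Finset ℂ) (fun s h => (∫⁻ u, β u ∂νN).toReal⁻¹ • Ec₈ s h) h8d' h8c' h8eq' h8g' (fun s h => (∫⁻ u, β u ∂νN).toReal⁻¹ • E₇ s h) h7d' h7c' h7eq' h7g'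
  -- ★ edition 3b at `P := {½}`
  exact siegelEisensteinContinuation_of_kinds_fixedCarrier L e dV hdV hdV0 dW hdW hdW0 lam hlam hw 𝒦 h𝒦 f hstd hcont νN β hβ hβ0 hβtop ({(1 / 2 : ℂ)} : Finset ℂ)
    Ec₀ hd₀ hc₀ hcoef₀ hbd₀ hgr₀ Ec₁ h1off hd₁ hc₁ (hcoef₁ νN β hβ hβ0 hβtop) hmaj₁ hgr₁
    EcW hWoff hWd hWc hWcoef
    (whittaker_majorant_of_weightedGrowth L hn e dV hdV dW hdW EcW w hw0 hws hWg) (whittaker_summedGrowth_of_weightedGrowth L e dV hdV dW hdW EcW w hws hWg)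

end Summit.HodgeConjecture.HodgeConjecture.Cruxes.HLiu418.K2LiuSiegelEisensteinContinuationTopEighteen

end
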